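import Summits.QuantumFields.BalabanUV.Beta.GAN24.TwoLevelDefectVanishing
import Summits.QuantumFields.BalabanUV.Beta.GAN24.MultiplierVertexBondSum
import Summits.QuantumFields.BalabanUV.Beta.GAN24.CubicSectorLevelDown

/-!
# `BalabanUV.Beta.GAN24.FieldResponseCoarseGradient` — binder row G-an2-4 ∕ (CONV-C), the (S) row ∕ (W-γ) one level up, the FIRST BRICK OF THE β-CHAIN (levels ≥ 2):
# **THE MULTIPLIER-KERNEL IMAGE OF ANY FIELD RESPONSE IS A COARSE GRADIENT —
# `wVH_{j+1}·Σ'_v Σ_l wΦ_{Lc^{j+1}} κ l (u − v)·(H_{j+1} g)(l,v) = stepScale_{j+1}·𝒬ᵀ_{Lc}(C_{j+1} g) κ u` for EVERY bounded datum `g`**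
# (centred root, every `j`; `(H_{j+1} g)(l,v) = Σ_μ Σ'_y g μ y·colH G_{j+1} Lc μ y l v`, `(C_{j+1} g)(ρ′,w) = Σ_μ Σ'_y g μ y·colM G_{j+1} Lc μ y ρ′ w`)
# (G-an2-4 CRUX TEAM (2), seat `b2b-balaban-gan24-formalise-leaf-06` = the (γ) hand, gen 50, memo `LEVELS-GE2.md` §2 (i))

NOT IN PRINT; OUR BOOKKEEPING ([folklore] Fubini bookkeeping BY NAME over leaf-06 g49's (T1) `DataColumnCombRows.E2row_colH_eq_contourSumAdj_colM_succ` ((E3) for ONE response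
column: the Euler–Lagrange equation of the data columns of `G_{j+1}` at every bond), `TwoLevelDefectVanishing.abs_tsum_colH_source_le` ∕ `PeriodicDataFaceSums.summable_abs_source_colH`
(the source series of a response column), `MultiplierVertexBondSum.abs_colM_le_fine`, `MultiplierZeroMass.summable_wΦ`; 0 `def`, 0 cited fact, 0 `def … : Prop`, 0 sorry).
HONEST FRAMING (cell contract, verbatim): «discharging `BetaPertH` makes Bałaban's UV stability UNCONDITIONAL — a real constructive-QFT result; it is NOT the continuum limit and NOT
the Clay problem.»  HONEST DEPENDENCY (verbatim): «continuum YM on T⁴ ⇐ BetaPertH ∧ nine spine estimates (0/9 proved); BetaPertH ⇐ (D1) ∧ (D4) ∧ CAP+tail; G-an2-4 gates asym,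
D1 and NE2/3/4.»

WHY (memo `HOME/b2b-balaban-gan24-formalise-leaf-06/g50/LEVELS-GE2.md`).  The level induction for road-P2's `hX` evaluates the level-`j` pairing at the RESPONSES
`(H_{j+1} h, H_{j+1} n, φ∘blk)` (`CubicSectorLevelDown.cubicSector_SrecAt_eq_levelDown`); the lower defects `(C2′)_k` then carry slot data `h_k = H_{k+1} g` that are responses of
BOUNDED (not single-column) data.  (δ2b)'s first step — «`C_j h` is a coarse gradient» — is (E3) for a single column; THIS FILE extends it by linearity and two Fubini steps to every
bounded datum `g`: `wVH_{j+1}·(wΦ_{Lc^{j+1}} ⋆ H_{j+1} g) = stepScale_{j+1}·𝒬ᵀ(C_{j+1} g)` — the β-chain link `C_j(H_{j+1} g) ∝ 𝒬ᵀ(C_{j+1} g)` of the memo, ready to iterate.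
* §1 `contourSumAdj_tsum_sum` (`𝒬ᵀ` commutes with a bounded superposition of multiplier columns), `summable_wΦ_mul_fieldResponse` (the `(v, y)` family is absolutely summable).
* §2 **`wΦ_fieldResponse_eq_contourSumAdj_multResponse`** — the statement in the title; §3 `multResponse_fieldResponse_eq` — the same in `colM` letters (`C_j(H_{j+1} g)`).
Asserts NO value of any resolvent column beyond (T1)'s Euler–Lagrange identity; NOTHING of the multi-level defect vanishing ∕ `hX` at levels ≥ 1 ∕ (W-γ)_{≥2} ∕ (INV) ∕ (S) discharged;
NEVER «G-an2-4 closed» as (CONV-C); NOT D1, NOT `BetaPertH`, NOT continuum, NOT Clay.  2026-08-23; no existing file touched.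
-/

noncomputable section

open Finset
open scoped BigOperators
open Literature.MathematicalPhysics.QuantumFieldTheory
open Literature.MathematicalPhysics.QuantumFieldTheory.Balaban1983to89
open Literature.MathematicalPhysics.QuantumFieldTheory.Balaban1983to89.Beta
open B12Sec2to5 (l1 l1_nonneg)
open ExpKernelCalculus (Site MKer Decays Zl Zl_nonneg summable_exp_shift' tsum_exp_shift')
open OneStepResolventKernel (Fib)
open LatticeForm (quo)
open AffineAveraging (Form1 box toSite unitVec contourSum)
open AffineReproduction (contourSumAdj)
open KKTFluctuationEnergy (contourSumAdj_eq)
open AveragingContoursRooted (ctrOff ctrOff_mem_box)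
open KernelSpecInstance (wΦ)
open OneStepKernelFamily (KInvStep colH)
open SecondOrderResponse (colM)
open BalabanStepJetsSucc (wVH)
open Summit.QuantumFields.BalabanUV.Beta.AxialDressingRooted (coDressKBmAt decays_coDressKBmAt_KInvStep one_le_of_neZero)
open Summit.QuantumFields.BalabanUV.Beta.BorderedHessian (stepScale)
open Summit.QuantumFields.BalabanUV.Beta.GAN24.MultiplierZeroMass (summable_wΦ)
open Summit.QuantumFields.BalabanUV.Beta.GAN24.MultiplierVertexBondSum (abs_colM_le_fine)
open Summit.QuantumFields.BalabanUV.Beta.GAN24.CoarseGaugeSourceResponse (summable_bdd_mul)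
open Summit.QuantumFields.BalabanUV.Beta.GAN24.DataColumnCombRows (E2row_colH_eq_contourSumAdj_colM_succ)
open Summit.QuantumFields.BalabanUV.Beta.GAN24.PeriodicDataFaceSums (summable_abs_source_colH)
open Summit.QuantumFields.BalabanUV.Beta.GAN24.TwoLevelDefectVanishing (abs_tsum_colH_source_le)

namespace Summit.QuantumFields.BalabanUV.Beta.GAN24.FieldResponseCoarseGradient

variable {d : ℕ} {Lc : ℕ} [NeZero Lc]

/-! ## §1 `𝒬ᵀ` of a bounded superposition of multiplier columns; summability of the `(v, y)` family -/

/-- [folklore] **`𝒬ᵀ` COMMUTES WITH A BOUNDED SUPERPOSITION OF MULTIPLIER COLUMNS** (centred root, every `j`, bounded `g`): the adjoint contour sum is a finite sum of evaluations,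
and each source series `y ↦ g μ y·colM G_j Lc μ y ρ′ w` is summable (the column decays in fine units from its source). -/
theorem contourSumAdj_tsum_sum (j : ℕ) {g : Form1 (d + 1) ℝ} {Bg : ℝ} (hg : ∀ μ y, |g μ y| ≤ Bg) (κ : Fin (d + 1)) (u : Site (d + 1)) :
    contourSumAdj Lc (fun ρ' w => ∑ μ, ∑' y : Site (d + 1), g μ y * colM (coDressKBmAt (toSite (ctrOff (d + 1) Lc)) Lc (KInvStep (d := d) Lc j)) Lc μ y ρ' w) κ u
      = ∑ μ, ∑' y : Site (d + 1), g μ y * contourSumAdj Lc (colM (coDressKBmAt (toSite (ctrOff (d + 1) Lc)) Lc (KInvStep (d := d) Lc j)) Lc μ y) κ u := by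
  classical
  have hLc1 : 1 ≤ Lc := one_le_of_neZero Lc
  obtain ⟨δG, CG, hδG, hCG, hG⟩ := decays_coDressKBmAt_KInvStep (d := d) (ctrOff_mem_box (d := d + 1) hLc1) j
  set G : MKer (d + 1) (Fib d) := coDressKBmAt (toSite (ctrOff (d + 1) Lc)) Lc (KInvStep (d := d) Lc j) with hGdef
  -- each source series is summable at every multiplier bond
  have hs : ∀ (μ ρ' : Fin (d + 1)) (w : Site (d + 1)), Summable fun y : Site (d + 1) => g μ y * colM G Lc μ y ρ' w := by
    intro μ ρ' w
    have hc : Summable fun y : Site (d + 1) => colM G Lc μ y ρ' w := by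
      refine Summable.of_norm_bounded ((summable_exp_shift' (D := d + 1) hδG w).mul_left CG |>.congr fun y => by rw [ExpKernelCalculus.l1_sub_symm]) (fun y => ?_)
      rw [Real.norm_eq_abs]
      exact abs_colM_le_fine (N := Lc) hG hδG.le μ y ρ' w
    exact summable_bdd_mul hc (fun y => hg μ y)
  rw [contourSumAdj_eq]
  simp only [contourSumAdj_eq]
  -- `Σ_s Σ_μ Σ'_y = Σ_μ Σ'_y Σ_s`
  rw [Finset.sum_comm]
  refine Finset.sum_congr rfl fun μ _ => ?_
  rw [← Summable.tsum_finsetSum (fun s _ => hs μ κ _)]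
  refine tsum_congr fun y => ?_
  rw [Finset.mul_sum]

/-- [folklore] **THE `(v, y)` FAMILY OF THE β-LINK IS ABSOLUTELY SUMMABLE** (centred root, every `j`, bounded `g`, every `κ l μ u`):
`(v, y) ↦ wΦ_{Lc^{j+1}} κ l (u − v)·g μ y·colH G_j Lc μ y l v` — the multiplier kernel is summable in `v`, the source series of the response column is bounded uniformly in `v`. -/
theorem summable_wΦ_mul_fieldResponse {N : ℕ} [NeZero N] (j : ℕ) {g : Form1 (d + 1) ℝ} {Bg : ℝ} (hg : ∀ μ y, |g μ y| ≤ Bg) (κ l μ : Fin (d + 1)) (u : Site (d + 1)) :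
    Summable (Function.uncurry fun (v : Site (d + 1)) (y : Site (d + 1)) =>
      wΦ (N := N) (d := d) κ l (u - v) * (g μ y * colH (coDressKBmAt (toSite (ctrOff (d + 1) Lc)) Lc (KInvStep (d := d) Lc j)) Lc μ y l v)) := by
  classical
  set G : MKer (d + 1) (Fib d) := coDressKBmAt (toSite (ctrOff (d + 1) Lc)) Lc (KInvStep (d := d) Lc j) with hGdef
  have hBg : 0 ≤ Bg := (abs_nonneg _).trans (hg 0 0)
  obtain ⟨CH, hCH0, hCH⟩ := abs_tsum_colH_source_le (d := d) (Lc := Lc) j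
  have hws : Summable fun v : Site (d + 1) => |wΦ (N := N) (d := d) κ l (u - v)| := by
    have h := ((Equiv.subLeft u).summable_iff.2 (summable_wΦ (N := N) (d := d) κ l)).abs
    exact h.congr fun v => by simp [Equiv.subLeft]
  -- majorant on the product: `|wΦ(u−v)|·Bg·|colH … v|`, summable by fibres (`y`) and marginal (`v`)
  have hg0 : ∀ p : Site (d + 1) × Site (d + 1), 0 ≤ |wΦ (N := N) (d := d) κ l (u - p.1)| * (Bg * |colH G Lc μ p.2 l p.1|) := fun p => by positivity
  have hfib : ∀ v : Site (d + 1), Summable fun y : Site (d + 1) => |wΦ (N := N) (d := d) κ l (u - v)| * (Bg * |colH G Lc μ y l v|) := fun v =>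
    ((summable_abs_source_colH (Lc := Lc) j μ l v).mul_left Bg).mul_left _
  have hmarg : Summable fun v : Site (d + 1) => ∑' y : Site (d + 1), |wΦ (N := N) (d := d) κ l (u - v)| * (Bg * |colH G Lc μ y l v|) := by
    have hle : ∀ v : Site (d + 1), (∑' y : Site (d + 1), |wΦ (N := N) (d := d) κ l (u - v)| * (Bg * |colH G Lc μ y l v|))
        ≤ |wΦ (N := N) (d := d) κ l (u - v)| * (Bg * CH) := by
      intro v
      rw [tsum_mul_left, tsum_mul_left]
      exact mul_le_mul_of_nonneg_left (mul_le_mul_of_nonneg_left (hCH μ l v) hBg) (abs_nonneg _)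
    exact Summable.of_nonneg_of_le (fun v => tsum_nonneg fun y => hg0 (v, y)) hle (hws.mul_right _)
  have hgs : Summable fun p : Site (d + 1) × Site (d + 1) => |wΦ (N := N) (d := d) κ l (u - p.1)| * (Bg * |colH G Lc μ p.2 l p.1|) :=
    (summable_prod_of_nonneg hg0).2 ⟨hfib, hmarg⟩
  refine Summable.of_norm_bounded hgs (fun p => ?_)
  obtain ⟨v, y⟩ := p
  rw [Real.norm_eq_abs, Function.uncurry_apply_pair, abs_mul, abs_mul]
  exact mul_le_mul_of_nonneg_left (mul_le_mul_of_nonneg_right (hg μ y) (abs_nonneg _)) (abs_nonneg _)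

/-! ## §2 The β-link: the multiplier-kernel image of a field response is a coarse gradient -/

/-- NOT IN PRINT; OUR BOOKKEEPING.  **THE MULTIPLIER-KERNEL IMAGE OF ANY FIELD RESPONSE IS A COARSE GRADIENT** (centred root `ρ = toSite (ctrOff (d+1) Lc)`, every `j`, every BOUNDED
datum `g`, every fine bond `(κ, u)`; `G_j = coDressKBmAt ρ Lc (KInvStep Lc j)`):
`wVH_j·Σ'_v Σ_l wΦ_{Lc^{j+1}} κ l (u − v)·(Σ_μ Σ'_y g μ y·colH G_{j+1} Lc μ y l v) = stepScale_{j+1}·𝒬ᵀ_{Lc}(ρ′ w ↦ Σ_μ Σ'_y g μ y·colM G_{j+1} Lc μ y ρ′ w) κ u`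
(weights `wVH d Lc (j+1)`, `stepScale d Lc (j+1)` as in (E3)) — (E3) `E2row_colH_eq_contourSumAdj_colM_succ` per source column, summed against `g` (two Fubini steps, §1).  For
`g = δ_{(ν,y′)}` this is (E3) itself; for `g = H_{j+2} g′` it is the link `C_j(H_{j+1} g) ∝ 𝒬ᵀ(C_{j+1} g)` of the β-chain. -/
theorem wΦ_fieldResponse_eq_contourSumAdj_multResponse (j : ℕ) {g : Form1 (d + 1) ℝ} {Bg : ℝ} (hg : ∀ μ y, |g μ y| ≤ Bg)
    (κ : Fin (d + 1)) (u : Site (d + 1)) :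
    wVH d Lc (j + 1) * (∑' v : Site (d + 1), ∑ l : Fin (d + 1), wΦ (N := Lc ^ (j + 1)) κ l (u - v)
        * (∑ μ, ∑' y : Site (d + 1), g μ y * colH (coDressKBmAt (toSite (ctrOff (d + 1) Lc)) Lc (KInvStep (d := d) Lc (j + 1))) Lc μ y l v))
      = stepScale d Lc (j + 1) * contourSumAdj Lc
          (fun ρ' w => ∑ μ, ∑' y : Site (d + 1), g μ y * colM (coDressKBmAt (toSite (ctrOff (d + 1) Lc)) Lc (KInvStep (d := d) Lc (j + 1))) Lc μ y ρ' w) κ u := by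
  classical
  have hLc1 : 1 ≤ Lc := one_le_of_neZero Lc
  have hr := ctrOff_mem_box (d := d + 1) hLc1
  set G : MKer (d + 1) (Fib d) := coDressKBmAt (toSite (ctrOff (d + 1) Lc)) Lc (KInvStep (d := d) Lc (j + 1)) with hGdef
  -- (E3) per source column
  have hE3 : ∀ (μ : Fin (d + 1)) (y : Site (d + 1)), wVH d Lc (j + 1) * (∑' v : Site (d + 1), ∑ l : Fin (d + 1), wΦ (N := Lc ^ (j + 1)) κ l (u - v) * colH G Lc μ y l v)
      = stepScale d Lc (j + 1) * contourSumAdj Lc (colM G Lc μ y) κ u := fun μ y => by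
    rw [hGdef]; exact E2row_colH_eq_contourSumAdj_colM_succ (d := d) hr j μ y κ u
  -- the `(v, y)` family per `(l, μ)` and its consequences
  have hF := fun (l μ : Fin (d + 1)) => summable_wΦ_mul_fieldResponse (d := d) (Lc := Lc) (N := Lc ^ (j + 1)) (j + 1) hg κ l μ u
  have hs_v : ∀ l μ, Summable fun v : Site (d + 1) => ∑' y : Site (d + 1), wΦ (N := Lc ^ (j + 1)) (d := d) κ l (u - v) * (g μ y * colH G Lc μ y l v) :=
    fun l μ => by simpa only [Function.uncurry_apply_pair] using (hF l μ).prod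
  have hs_y : ∀ l μ, Summable fun y : Site (d + 1) => ∑' v : Site (d + 1), wΦ (N := Lc ^ (j + 1)) (d := d) κ l (u - v) * (g μ y * colH G Lc μ y l v) :=
    fun l μ => by simpa only [Function.uncurry_apply_pair, Prod.swap_prod_mk] using (hF l μ).prod_symm.prod
  have hs_vy : ∀ l μ v, Summable fun y : Site (d + 1) => wΦ (N := Lc ^ (j + 1)) (d := d) κ l (u - v) * (g μ y * colH G Lc μ y l v) :=
    fun l μ v => by simpa only [Function.uncurry_apply_pair] using (hF l μ).prod_factor v
  have hs_yv : ∀ l μ y, Summable fun v : Site (d + 1) => wΦ (N := Lc ^ (j + 1)) (d := d) κ l (u - v) * (g μ y * colH G Lc μ y l v) :=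
    fun l μ y => by simpa only [Function.uncurry_apply_pair, Prod.swap_prod_mk] using (hF l μ).prod_symm.prod_factor y
  -- LHS: push the kernel inside, exchange `(v, y)`, pull `g` out
  have e1 : (∑' v : Site (d + 1), ∑ l : Fin (d + 1), wΦ (N := Lc ^ (j + 1)) κ l (u - v) * (∑ μ, ∑' y : Site (d + 1), g μ y * colH G Lc μ y l v))
      = ∑ μ, ∑' y : Site (d + 1), g μ y * (∑' v : Site (d + 1), ∑ l : Fin (d + 1), wΦ (N := Lc ^ (j + 1)) κ l (u - v) * colH G Lc μ y l v) := by
    -- summand: `Σ_l wΦ·Σ_μ Σ'_y g·colH = Σ_l Σ_μ Σ'_y wΦ·(g·colH)`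
    have ept : ∀ v : Site (d + 1), (∑ l : Fin (d + 1), wΦ (N := Lc ^ (j + 1)) κ l (u - v) * (∑ μ, ∑' y : Site (d + 1), g μ y * colH G Lc μ y l v))
        = ∑ l : Fin (d + 1), ∑ μ, ∑' y : Site (d + 1), wΦ (N := Lc ^ (j + 1)) (d := d) κ l (u - v) * (g μ y * colH G Lc μ y l v) := by
      intro v
      refine Finset.sum_congr rfl fun l _ => ?_
      rw [Finset.mul_sum]
      refine Finset.sum_congr rfl fun μ _ => ?_
      rw [← tsum_mul_left]
    rw [tsum_congr ept, Summable.tsum_finsetSum (fun l _ => summable_sum fun μ _ => hs_v l μ)]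
    have e2 : ∀ l, (∑' v : Site (d + 1), ∑ μ, ∑' y : Site (d + 1), wΦ (N := Lc ^ (j + 1)) (d := d) κ l (u - v) * (g μ y * colH G Lc μ y l v))
        = ∑ μ, ∑' y : Site (d + 1), ∑' v : Site (d + 1), wΦ (N := Lc ^ (j + 1)) (d := d) κ l (u - v) * (g μ y * colH G Lc μ y l v) := by
      intro l
      rw [Summable.tsum_finsetSum (fun μ _ => hs_v l μ)]
      exact Finset.sum_congr rfl fun μ _ => ((hF l μ).tsum_comm).symm
    rw [Finset.sum_congr rfl fun l _ => e2 l, Finset.sum_comm]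
    refine Finset.sum_congr rfl fun μ _ => ?_
    rw [← Summable.tsum_finsetSum (fun l _ => hs_y l μ)]
    refine tsum_congr fun y => ?_
    obtain ⟨δG, CG, hδG, hCG, hG⟩ := decays_coDressKBmAt_KInvStep (d := d) hr (j + 1)
    have hsl : ∀ l, Summable fun v : Site (d + 1) => wΦ (N := Lc ^ (j + 1)) (d := d) κ l (u - v) * colH G Lc μ y l v := fun l => by
      have hws : Summable fun v : Site (d + 1) => wΦ (N := Lc ^ (j + 1)) (d := d) κ l (u - v) := by
        have h := (Equiv.subLeft u).summable_iff.2 (summable_wΦ (N := Lc ^ (j + 1)) (d := d) κ l)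
        exact h.congr fun v => by simp [Equiv.subLeft]
      have hb : ∀ v : Site (d + 1), |colH G Lc μ y l v| ≤ CG := fun v => (hG v ((Lc : ℤ) • y) (Sum.inl l) (Sum.inr μ)).trans
        (mul_le_of_le_one_right hCG (by rw [Real.exp_le_one_iff]; have := l1_nonneg (v - (Lc : ℤ) • y); nlinarith))
      exact (summable_bdd_mul hws hb).congr fun v => by ring
    rw [Summable.tsum_finsetSum (fun l _ => hsl l), Finset.mul_sum]
    refine Finset.sum_congr rfl fun l _ => ?_
    rw [← tsum_mul_left]
    exact tsum_congr fun v => by ring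
  rw [e1, Finset.mul_sum, contourSumAdj_tsum_sum (d := d) (Lc := Lc) (j + 1) hg κ u, Finset.mul_sum]
  refine Finset.sum_congr rfl fun μ _ => ?_
  -- summability of `y ↦ g μ y·(wΦ ⋆ colH_{μ y})` follows from (E3) + the summability of the `𝒬ᵀ colM` series
  have hsQ : Summable fun y : Site (d + 1) => g μ y * contourSumAdj Lc (colM G Lc μ y) κ u := by
    obtain ⟨δG, CG, hδG, hCG, hG⟩ := decays_coDressKBmAt_KInvStep (d := d) hr (j + 1)
    simp only [contourSumAdj_eq, Finset.mul_sum]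
    refine summable_sum fun s _ => ?_
    have hc : Summable fun y : Site (d + 1) => colM G Lc μ y κ (quo Lc (u - (s : ℤ) • unitVec κ)) := by
      refine Summable.of_norm_bounded (((summable_exp_shift' (D := d + 1) hδG (quo Lc (u - (s : ℤ) • unitVec κ))).mul_left CG).congr
        fun y => by rw [ExpKernelCalculus.l1_sub_symm]) (fun y => ?_)
      rw [Real.norm_eq_abs]
      exact abs_colM_le_fine (N := Lc) hG hδG.le μ y κ (quo Lc (u - (s : ℤ) • unitVec κ))
    exact summable_bdd_mul hc (fun y => hg μ y)
  have hsW : Summable fun y : Site (d + 1) => g μ y * (∑' v : Site (d + 1), ∑ l : Fin (d + 1), wΦ (N := Lc ^ (j + 1)) κ l (u - v) * colH G Lc μ y l v) := by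
    have hwVH : wVH d Lc (j + 1) ≠ 0 := by
      unfold BalabanStepJetsSucc.wVH; exact pow_ne_zero _ (pow_ne_zero _ (by exact_mod_cast NeZero.ne Lc))
    have e : ∀ y, g μ y * (∑' v : Site (d + 1), ∑ l : Fin (d + 1), wΦ (N := Lc ^ (j + 1)) κ l (u - v) * colH G Lc μ y l v)
        = (wVH d Lc (j + 1))⁻¹ * stepScale d Lc (j + 1) * (g μ y * contourSumAdj Lc (colM G Lc μ y) κ u) := by
      intro y
      have h := hE3 μ y
      have : (∑' v : Site (d + 1), ∑ l : Fin (d + 1), wΦ (N := Lc ^ (j + 1)) κ l (u - v) * colH G Lc μ y l v)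
          = (wVH d Lc (j + 1))⁻¹ * (stepScale d Lc (j + 1) * contourSumAdj Lc (colM G Lc μ y) κ u) := by
        rw [← h, ← mul_assoc, inv_mul_cancel₀ hwVH, one_mul]
      rw [this]; ring
    simp only [e]
    exact hsQ.mul_left _
  rw [← tsum_mul_left, ← tsum_mul_left]
  refine tsum_congr fun y => ?_
  have h := hE3 μ y
  calc wVH d Lc (j + 1) * (g μ y * ∑' v : Site (d + 1), ∑ l : Fin (d + 1), wΦ (N := Lc ^ (j + 1)) κ l (u - v) * colH G Lc μ y l v)
      = g μ y * (wVH d Lc (j + 1) * ∑' v : Site (d + 1), ∑ l : Fin (d + 1), wΦ (N := Lc ^ (j + 1)) κ l (u - v) * colH G Lc μ y l v) := by ring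
    _ = g μ y * (stepScale d Lc (j + 1) * contourSumAdj Lc (colM G Lc μ y) κ u) := by rw [h]
    _ = stepScale d Lc (j + 1) * (g μ y * contourSumAdj Lc (colM G Lc μ y) κ u) := by ring

/-! ## §3 The same in `colM` letters: `C_j(H_{j+1} g) = (stepScale_{j+1} ∕ wVH_{j+1})·𝒬ᵀ(C_{j+1} g)` -/

/-- [folklore] **THE β-LINK IN MULTIPLIER-COLUMN LETTERS** (centred root, every `j`, every bounded datum `g`, every multiplier bond `(κ, u)`):
`wVH_{j+1}·C_j(H_{j+1} g)(κ, u) = stepScale_{j+1}·𝒬ᵀ_{Lc}(C_{j+1} g) κ u`, where `(H_{j+1} g)(a, v) = Σ_μ Σ'_y g μ y·colH G_{j+1} Lc μ y a v` and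
`(C_k m)(κ, u) = Σ_a Σ'_v m a v·colM G_k Lc a v κ u` (the letters of `WilsonSectorSourcePairingZero` ∕ `TwoLevelDefectVanishing`): §2 after `colM G_j Lc a v κ u = wΦ_{Lc^{j+1}} κ a (u − v)`
(`KernelWardMColumn.colM_coDressKBmAt` ⨾ `MultiplierZeroMass.colM_KInvStep`) and one exchange of the finite slot sum with the `v`-series. -/
theorem multResponse_fieldResponse_eq (j : ℕ) {g : Form1 (d + 1) ℝ} {Bg : ℝ} (hg : ∀ μ y, |g μ y| ≤ Bg) (κ : Fin (d + 1)) (u : Site (d + 1)) :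
    wVH d Lc (j + 1) * (∑ a : Fin (d + 1), ∑' v : Site (d + 1),
        (∑ μ, ∑' y : Site (d + 1), g μ y * colH (coDressKBmAt (toSite (ctrOff (d + 1) Lc)) Lc (KInvStep (d := d) Lc (j + 1))) Lc μ y a v)
          * colM (coDressKBmAt (toSite (ctrOff (d + 1) Lc)) Lc (KInvStep (d := d) Lc j)) Lc a v κ u)
      = stepScale d Lc (j + 1) * contourSumAdj Lc
          (fun ρ' w => ∑ μ, ∑' y : Site (d + 1), g μ y * colM (coDressKBmAt (toSite (ctrOff (d + 1) Lc)) Lc (KInvStep (d := d) Lc (j + 1))) Lc μ y ρ' w) κ u := by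
  classical
  rw [← wΦ_fieldResponse_eq_contourSumAdj_multResponse (d := d) (Lc := Lc) j hg κ u]
  refine congrArg (fun t : ℝ => wVH d Lc (j + 1) * t) ?_
  set G : MKer (d + 1) (Fib d) := coDressKBmAt (toSite (ctrOff (d + 1) Lc)) Lc (KInvStep (d := d) Lc (j + 1)) with hGdef
  simp only [Summit.QuantumFields.BalabanUV.Beta.KernelWardMColumn.colM_coDressKBmAt, Summit.QuantumFields.BalabanUV.Beta.GAN24.MultiplierZeroMass.colM_KInvStep]
  -- `v ↦ wΦ κ a (u − v)·(H_{j+1} g)(a, v)` is summable (§1, summed over `μ`)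
  have hs : ∀ a : Fin (d + 1), Summable fun v : Site (d + 1) =>
      wΦ (N := Lc ^ (j + 1)) (d := d) κ a (u - v) * (∑ μ, ∑' y : Site (d + 1), g μ y * colH G Lc μ y a v) := fun a => by
    have h1 : ∀ μ : Fin (d + 1), Summable fun v : Site (d + 1) => ∑' y : Site (d + 1), wΦ (N := Lc ^ (j + 1)) (d := d) κ a (u - v) * (g μ y * colH G Lc μ y a v) :=
      fun μ => by simpa only [Function.uncurry_apply_pair] using (summable_wΦ_mul_fieldResponse (d := d) (Lc := Lc) (N := Lc ^ (j + 1)) (j + 1) hg κ a μ u).prod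
    refine (summable_sum fun μ (_ : μ ∈ (Finset.univ : Finset (Fin (d + 1)))) => h1 μ).congr fun v => ?_
    rw [Finset.mul_sum]
    exact Finset.sum_congr rfl fun μ _ => tsum_mul_left
  rw [Summable.tsum_finsetSum (fun a _ => hs a)]
  exact Finset.sum_congr rfl fun a _ => tsum_congr fun v => mul_comm _ _

end Summit.QuantumFields.BalabanUV.Beta.GAN24.FieldResponseCoarseGradient

end
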